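import Mathlib.NumberTheory.NumberField.Discriminant.Defs
import Mathlib.NumberTheory.RamificationInertia.Basic
import Mathlib.RingTheory.Norm.Basic
import Mathlib.Data.ZMod.QuotientRing
import HarnessLib

/-!
# The Heegner condition: `d_K ≡ β² (mod 4N)` and `𝓞_K/𝔫 ≅ ℤ/Nℤ` when every `p ∣ N` splits

For an imaginary quadratic field `K` and a level `N ≥ 1`, the **Heegner hypothesis** "every prime
`p ∣ N` splits in `K`" (Gross 1984, §3; Gross–Zagier 1986, I.§3; Gross 1991, §1: "where all prime
factors of `N` are split"; Darmon 2004, Hypothesis 3.9) is used in two equivalent printed forms: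

* (Gross 1991, §1, p. 235) "Choose an ideal `𝒩` of `𝒪` with `𝒪/𝒩 ≅ ℤ/Nℤ`" — such an ideal
  exists (Darmon 2004, Prop. 3.8: `CM(𝒪) ≠ ∅`, i.e. a ring homomorphism `𝒪 → ℤ/Nℤ` exists, iff all
  primes dividing `N` split, for `(disc 𝒪, N) = 1`);
* (Gross 1984, §3; Gross–Zagier 1986, I.§3–4; Gross–Kohnen–Zagier 1987, §I.1) `D = d_K` is a
  square modulo `4N`: `D ≡ β² (mod 4N)`, and then `𝔫 = (N, (β + √D)/2)`; the residue `β mod 2N`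
  indexes the Heegner forms `(A, B, C)` with `N ∣ A`, `B ≡ β (mod 2N)`.

This file **proves** both consequences for an arbitrary quadratic number field (`[K : ℚ] = 2`,
no sign condition) from Mathlib's Dedekind-domain API, *without computing `𝓞 K`*:

* `Literature.NumberTheory.QuadraticFields.Quadratic.exists_basis_zero_eq_one`: `𝓞 K` has a `ℤ`-basis `(1, ω)` (`1` is primitive in
  the lattice `𝓞 K` because an integer that is a unit of `𝓞 K` is `±1`, by the norm);
  `discr_eq_sq_add_four_mul`: with `ω² = m + tω`, `d_K = t² + 4m` (trace form on `(1, ω)`);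
  `exists_sq_eq_discr`: `δ = 2ω − t ∈ 𝓞 K` has `δ² = d_K`, and `d_K ≡ 0, 1 (mod 4)`
  (`discr_emod_four`, Stickelberger) — Marcus, *Number Fields*, Ch. 2, Thm. 1.
* `Literature.NumberTheory.QuadraticFields.SplitPrime.nonempty_ringEquiv_zmod_pow`: for a prime `𝔭` of a Dedekind domain `S`, finite
  free over `ℤ`, above `p` with `e(𝔭|p) = f(𝔭|p) = 1`, `S ⧸ 𝔭ᵏ ≃+* ZMod (p ^ k)` for every `k`
  (it has `pᵏ` elements, `natCard_quotient_pow`, via `Ideal.absNorm_eq_pow_inertiaDeg'`, and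
  characteristic `pᵏ`, `charP_quotient_pow`, via `m ∈ 𝔭ᵏ ↔ pᵏ ∣ m`, `intCast_mem_pow_iff`, from
  `Ideal.IsDedekindDomain.emultiplicity_map_eq_ramificationIdx'_mul`);
  `ramificationIdx_eq_one_of_ncard_primesOver`: a rational prime with `[K : ℚ]` primes of `𝓞 K`
  above it is totally split, `e = f = 1` (fundamental identity `Ideal.sum_ramification_inertia`);
  `exists_ideal_quotient_ringEquiv_zmod`: if every `p ∣ N` is totally split in the number field
  `K`, some ideal `𝔫` has `𝓞 K ⧸ 𝔫 ≃+* ZMod N` (Chinese remainder theorem,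
  `Ideal.quotientInfRingEquivPiQuotient`, `ZMod.equivPi`).
* `Literature.NumberTheory.QuadraticFields.Quadratic.exists_dvd_sq_sub_discr_of_ncard_primesOver`: if `[K : ℚ] = 2` and every prime
  `p ∣ N` has two primes of `𝓞 K` above it, then `4N ∣ β² − d_K` for some `β ∈ ℤ` (reduce `δ`
  modulo `𝔭ᵏ ≅ ℤ/pᵏ` for `p ∣ N`, use `d_K ≡ t² (mod 4)` at `2 ∤ N`, glue by the CRT for square
  roots `Int.exists_dvd_sq_sub_of_forall_prime_pow`); and
  `exists_ideal_quotient_ringEquiv_zmod_of_ncard_eq_two`: `𝓞 K ⧸ 𝔫 ≃+* ZMod N` for some `𝔫`.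

The first of these is exactly the hypothesis-to-conclusion content of the named fact
`Literature.NumberTheory.EllipticCurves.exists_dvd_sq_sub_discr` of `Literature.NumberTheory.EllipticCurves.HeegnerPoints`
(discharged in `HeegnerPointsProofs`). Everything here is proved (no named facts). Mathlib has the
ingredients listed above but neither the ring of integers / discriminant of a quadratic field nor
"totally split" as a notion (searched `TotallySplit`, `QuadraticField`, `sq_mod_four`).

## References

* B. H. Gross, *Heegner points on `X₀(N)`*, in *Modular Forms* (Durham 1983), Horwood (1984),
  87–105, §3.
* B. H. Gross, D. B. Zagier, *Heegner points and derivatives of `L`-series*, Invent. Math. 84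
  (1986), 225–320, I.§3.
* B. H. Gross, *Kolyvagin's work on modular elliptic curves*, in *`L`-functions and arithmetic*
  (Durham 1989), LMS Lecture Note Ser. 153 (1991), 235–256, §1 (p. 235).
* H. Darmon, *Rational points on modular elliptic curves*, CBMS 101, AMS (2004), §3.4, Prop. 3.8
  and Hypothesis 3.9.
* D. A. Marcus, *Number Fields*, Universitext, 2nd ed. (2018), Ch. 2, Thm. 1 (integral basis and
  discriminant of a quadratic field); Ch. 3, Thm. 21 and Thm. 25 (`∑ eᵢfᵢ = n`; splitting of primes
  in quadratic fields).
-/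

noncomputable section

open scoped Classical

open Module NumberField

namespace Literature.NumberTheory.QuadraticFields.Quadratic

variable {K : Type*} [Field K] [NumberField K]

/-- If an integer `g` becomes a unit in `𝓞 K`, then `g = ±1` (take norms: `N(g) = g^{[K:ℚ]}`).
[folklore] -/
theorem isUnit_of_isUnit_intCast {g : ℤ} (hg : IsUnit (g : 𝓞 K)) : IsUnit g := by
  have h := hg.map (Algebra.norm ℤ)
  rw [show (g : 𝓞 K) = algebraMap ℤ (𝓞 K) g from rfl, Algebra.norm_algebraMap] at h
  have hn : finrank ℤ (𝓞 K) ≠ 0 := by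
    rw [RingOfIntegers.rank]; exact Module.finrank_pos.ne'
  exact (isUnit_pow_iff hn).mp h

/-- **An integral basis of a quadratic field containing `1`.** If `[K : ℚ] = 2` there is a
`ℤ`-basis `(1, ω)` of `𝓞 K` (Marcus, *Number Fields*, Ch. 2, Thm. 1 and Ex. 27: `1` is
primitive in the lattice `𝓞 K` since `𝓞 K ∩ ℚ = ℤ`, hence part of a basis). [folklore] -/
theorem exists_basis_zero_eq_one (h2 : finrank ℚ K = 2) :
    ∃ b : Basis (Fin 2) ℤ (𝓞 K), b 0 = 1 := by
  have hcard : Fintype.card (Free.ChooseBasisIndex ℤ (𝓞 K)) = 2 := by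
    rw [← finrank_eq_card_chooseBasisIndex, RingOfIntegers.rank, h2]
  set e : Basis (Fin 2) ℤ (𝓞 K) :=
    (RingOfIntegers.basis K).reindex (Fintype.equivFinOfCardEq hcard) with he
  set a : ℤ := e.repr 1 0 with ha
  set c : ℤ := e.repr 1 1 with hc
  have h1 : (1 : 𝓞 K) = a • e 0 + c • e 1 := by
    conv_lhs => rw [← e.sum_repr 1]
    simp [Fin.sum_univ_two, ha, hc]
  -- `gcd(a, c) = 1`: otherwise `1/gcd ∈ 𝓞 K`
  have hg : Int.gcd a c = 1 := by
    obtain ⟨a', ha'⟩ := Int.gcd_dvd_left a c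
    obtain ⟨c', hc'⟩ := Int.gcd_dvd_right a c
    have hx : ((Int.gcd a c : ℤ) : 𝓞 K) * (a' • e 0 + c' • e 1) = 1 := by
      rw [← zsmul_eq_mul, smul_add, smul_smul, smul_smul, ← ha', ← hc', ← h1]
    have hu : IsUnit ((Int.gcd a c : ℤ) : 𝓞 K) := isUnit_iff_exists_inv.mpr ⟨_, hx⟩
    have hu' := isUnit_of_isUnit_intCast hu
    rw [Int.isUnit_iff] at hu'
    rcases hu' with h | h
    · exact_mod_cast h
    · omega
  -- Bezout
  have hbez : a * Int.gcdA a c + c * Int.gcdB a c = 1 := by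
    rw [← Int.gcd_eq_gcd_ab, hg]; rfl
  set u := Int.gcdA a c
  set v := Int.gcdB a c
  set ω : 𝓞 K := (-v) • e 0 + u • e 1 with hω
  set w : Fin 2 → 𝓞 K := ![1, ω] with hw
  have hdet : e.det w = 1 := by
    rw [e.det_apply, Matrix.det_fin_two]
    simp only [e.toMatrix_apply, hw, Matrix.cons_val_zero, Matrix.cons_val_one]
    rw [hω, map_add, map_zsmul, map_zsmul, e.repr_self, e.repr_self]
    simp only [Finsupp.coe_add, Finsupp.coe_smul, Pi.add_apply, Pi.smul_apply,
      Finsupp.single_apply, smul_eq_mul]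
    simp only [Fin.zero_eq_one_iff, OfNat.ofNat_ne_one, if_false, if_true,
      mul_one, mul_zero, add_zero, zero_add, one_ne_zero]
    rw [← ha, ← hc]
    linear_combination hbez
  obtain ⟨hli, hsp⟩ := (Module.Basis.is_basis_iff_det e).mpr (hdet ▸ isUnit_one)
  exact ⟨Basis.mk hli hsp.ge, by simp [hw]⟩

omit [NumberField K] in
/-- For a `ℤ`-basis `(1, ω)` of `𝓞 K`: `ω² = m + t ω` with `m, t` the coordinates of `ω²`.
[folklore] -/
theorem basis_one_mul_self_eq (b : Basis (Fin 2) ℤ (𝓞 K)) (hb : b 0 = 1) :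
    b 1 * b 1 = (b.repr (b 1 * b 1) 0 : 𝓞 K) + (b.repr (b 1 * b 1) 1 : 𝓞 K) * b 1 := by
  conv_lhs => rw [← b.sum_repr (b 1 * b 1)]
  rw [Fin.sum_univ_two, hb, zsmul_eq_mul, mul_one, zsmul_eq_mul]

/-- **The discriminant of a quadratic field from a basis `(1, ω)`.** If `(1, ω)` is a `ℤ`-basis of
`𝓞 K` and `ω² = m + t ω` (`m, t ∈ ℤ` the coordinates of `ω²`), then `d_K = t² + 4m`: the trace
form has matrix `[[2, t], [t, t² + 2m]]` (Marcus, *Number Fields*, Ch. 2, Thm. 1 and Ex. 27: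
`disc(1, ω) = (ω − ω')²`). [folklore] -/
theorem discr_eq_sq_add_four_mul (b : Basis (Fin 2) ℤ (𝓞 K)) (hb : b 0 = 1) :
    NumberField.discr K = (b.repr (b 1 * b 1) 1) ^ 2 + 4 * b.repr (b 1 * b 1) 0 := by
  set ω := b 1 with hω
  set m : ℤ := b.repr (ω * ω) 0
  set t : ℤ := b.repr (ω * ω) 1
  have hωω : ω * ω = (m : 𝓞 K) + (t : 𝓞 K) * ω := basis_one_mul_self_eq b hb
  have tr1 : Algebra.trace ℤ (𝓞 K) 1 = 2 := by
    rw [← (algebraMap ℤ (𝓞 K)).map_one, Algebra.trace_algebraMap_of_basis b]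
    simp
  have hrepr0 : b.repr ω 0 = 0 := by
    rw [hω, b.repr_self]
    simp
  have trω : Algebra.trace ℤ (𝓞 K) ω = t := by
    rw [Algebra.trace_eq_matrix_trace b, Matrix.trace_fin_two, Algebra.leftMulMatrix_eq_repr_mul,
      Algebra.leftMulMatrix_eq_repr_mul, hb, mul_one, hrepr0, zero_add]
  have trωω : Algebra.trace ℤ (𝓞 K) (ω * ω) = t ^ 2 + 2 * m := by
    rw [hωω, map_add, ← zsmul_eq_mul, map_zsmul, trω, smul_eq_mul,
      show (m : 𝓞 K) = algebraMap ℤ (𝓞 K) m from rfl, Algebra.trace_algebraMap_of_basis b]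
    simp
    ring
  rw [← NumberField.discr_eq_discr K b, Algebra.discr_def, Matrix.det_fin_two,
    Algebra.traceMatrix_apply, Algebra.traceMatrix_apply, Algebra.traceMatrix_apply,
    Algebra.traceMatrix_apply, Algebra.traceForm_apply, Algebra.traceForm_apply,
    Algebra.traceForm_apply, Algebra.traceForm_apply, hb, mul_one, mul_one, one_mul, tr1, trω,
    ← hω, trωω]
  ring

/-- **`√d_K ∈ 𝓞 K` and `d_K ≡ 0, 1 (mod 4)` for a quadratic field.** If `[K : ℚ] = 2` then
`d_K = t² + 4m` for some `t, m ∈ ℤ` (Stickelberger's congruence `d_K ≡ t² (mod 4)`) and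
`d_K = δ²` for some `δ ∈ 𝓞 K` (for an integral basis `(1, ω)` with `ω² = m + tω`, take
`δ = 2ω − t = ω − ω'`); in particular `K = ℚ(√d_K)` (Marcus, *Number Fields*, Ch. 2, Thm. 1).
[folklore] -/
theorem exists_sq_eq_discr (h2 : finrank ℚ K = 2) :
    ∃ (t m : ℤ) (δ : 𝓞 K), NumberField.discr K = t ^ 2 + 4 * m ∧ δ ^ 2 = NumberField.discr K := by
  obtain ⟨b, hb⟩ := exists_basis_zero_eq_one h2
  refine ⟨b.repr (b 1 * b 1) 1, b.repr (b 1 * b 1) 0, 2 * b 1 - b.repr (b 1 * b 1) 1,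
    discr_eq_sq_add_four_mul b hb, ?_⟩
  rw [discr_eq_sq_add_four_mul b hb]
  push_cast
  linear_combination (4 : 𝓞 K) * basis_one_mul_self_eq b hb

/-- Stickelberger for quadratic fields: `d_K ≡ 0` or `1 (mod 4)`. [folklore] -/
theorem discr_emod_four (h2 : finrank ℚ K = 2) :
    NumberField.discr K % 4 = 0 ∨ NumberField.discr K % 4 = 1 := by
  obtain ⟨t, m, -, hD, -⟩ := exists_sq_eq_discr (K := K) h2
  rw [hD]
  rcases Int.even_or_odd t with ⟨s, rfl⟩ | ⟨s, rfl⟩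
  · left
    rw [show (s + s) ^ 2 + 4 * m = 4 * (s ^ 2 + m) by ring]
    exact Int.mul_emod_right 4 _
  · right
    rw [show (2 * s + 1) ^ 2 + 4 * m = 1 + 4 * (s ^ 2 + s + m) by ring, Int.add_mul_emod_self_left]
    decide

end Literature.NumberTheory.QuadraticFields.Quadratic

/-! ### Primes of degree one: `S ⧸ 𝔭ᵏ ≅ ℤ/pᵏ` -/

namespace Literature.NumberTheory.QuadraticFields.SplitPrime

open Ideal

section DegreeOne

variable {S : Type*} [CommRing S] [IsDedekindDomain S] [Module.Free ℤ S] [Module.Finite ℤ S]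
  [CharZero S]

omit [Module.Free ℤ S] [Module.Finite ℤ S] in
/-- For a prime `𝔭` of `S` above `p` with ramification index `e(𝔭|p) = 1` and an integer `m`:
`m ∈ 𝔭ᵏ ↔ pᵏ ∣ m` (the `𝔭`-adic valuation of `m` is `e · v_p(m) = v_p(m)`; Marcus, *Number Fields*,
Ch. 3, Thm. 21 ff.). [folklore] -/
theorem intCast_mem_pow_iff {p : ℕ} (hp : p.Prime) (P : Ideal S) [hP : P.IsPrime]
    [P.LiesOver (span {(p : ℤ)})] (he : ramificationIdx' (span {(p : ℤ)}) P = 1) (k : ℕ) (m : ℤ) :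
    (m : S) ∈ P ^ k ↔ (p : ℤ) ^ k ∣ m := by
  rcases eq_or_ne m 0 with rfl | hm
  · simp
  have hp0 : (span {(p : ℤ)} : Ideal ℤ) ≠ ⊥ := by
    simpa using (Int.natCast_ne_zero.mpr hp.ne_zero)
  have hP0 : P ≠ ⊥ := ne_bot_of_liesOver_of_ne_bot hp0 P
  have hv : Irreducible (span {(p : ℤ)} : Ideal ℤ) :=
    (prime_of_isPrime hp0 ((span_singleton_prime (Int.natCast_ne_zero.mpr hp.ne_zero)).mpr
      (Nat.prime_iff_prime_int.mp hp))).irreducible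
  have hw : Irreducible P := (prime_of_isPrime hP0 hP).irreducible
  have hspan : span {(m : S)} = (span {m}).map (algebraMap ℤ S) := by
    rw [map_span, Set.image_singleton, eq_intCast]
  rw [← dvd_span_singleton, hspan, pow_dvd_iff_le_emultiplicity,
    IsDedekindDomain.emultiplicity_map_eq_ramificationIdx'_mul (by simpa using hm) hv hw hP0, he,
    Nat.cast_one, one_mul, ← pow_dvd_iff_le_emultiplicity, span_singleton_pow,
    Ideal.span_singleton_dvd_span_singleton_iff_dvd]

omit [CharZero S] in
/-- For a prime `𝔭` of `S` above `p` with residue degree `f(𝔭|p) = 1`: `#(S ⧸ 𝔭ᵏ) = pᵏ`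
(`N(𝔭ᵏ) = N(𝔭)ᵏ = p^{fk}`). [folklore] -/
theorem natCard_quotient_pow {p : ℕ} (hp : p.Prime) (P : Ideal S) [P.IsPrime]
    [P.LiesOver (span {(p : ℤ)})] (hf : inertiaDeg' (span {(p : ℤ)}) P = 1) (k : ℕ) :
    Nat.card (S ⧸ P ^ k) = p ^ k := by
  rw [← Submodule.cardQuot_apply, ← absNorm_apply, map_pow, absNorm_eq_pow_inertiaDeg' P hp, hf,
    pow_one]

omit [Module.Free ℤ S] [Module.Finite ℤ S] in
/-- For a prime `𝔭` of `S` above `p` with `e(𝔭|p) = 1`, the ring `S ⧸ 𝔭ᵏ` has characteristic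
`pᵏ`. [folklore] -/
theorem charP_quotient_pow {p : ℕ} (hp : p.Prime) (P : Ideal S) [P.IsPrime]
    [P.LiesOver (span {(p : ℤ)})] (he : ramificationIdx' (span {(p : ℤ)}) P = 1) (k : ℕ) :
    CharP (S ⧸ P ^ k) (p ^ k) :=
  ⟨fun x ↦ by
    rw [← map_natCast (Ideal.Quotient.mk (P ^ k)), Ideal.Quotient.eq_zero_iff_mem,
      ← Int.cast_natCast, intCast_mem_pow_iff hp P he k x]
    exact_mod_cast Iff.rfl⟩

/-- **A prime of degree one with `e = f = 1` has `S ⧸ 𝔭ᵏ ≅ ℤ/pᵏℤ`** for every `k` (the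
quotient has `pᵏ` elements and characteristic `pᵏ`); for a number field this is
`𝓞_K/𝔭ᵏ ≅ ℤ_p/pᵏ ≅ ℤ/pᵏ` for a split (unramified, degree-one) prime (Marcus, *Number Fields*,
Ch. 3; Gross 1984, §3: the ideal `𝔫` with `𝓞/𝔫 ≅ ℤ/N`). [folklore] -/
theorem nonempty_ringEquiv_zmod_pow {p : ℕ} (hp : p.Prime) (P : Ideal S) [P.IsPrime]
    [P.LiesOver (span {(p : ℤ)})] (he : ramificationIdx' (span {(p : ℤ)}) P = 1)
    (hf : inertiaDeg' (span {(p : ℤ)}) P = 1) (k : ℕ) :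
    Nonempty (S ⧸ P ^ k ≃+* ZMod (p ^ k)) := by
  haveI : Finite (S ⧸ P ^ k) := Nat.finite_of_card_ne_zero
    (by rw [natCard_quotient_pow hp P hf k]; exact pow_ne_zero _ hp.ne_zero)
  letI := Fintype.ofFinite (S ⧸ P ^ k)
  haveI := charP_quotient_pow hp P he k
  have hcard : Fintype.card (S ⧸ P ^ k) = p ^ k := by
    rw [Fintype.card_eq_nat_card, natCard_quotient_pow hp P hf k]
  exact ⟨(ZMod.ringEquiv (S ⧸ P ^ k) hcard).symm⟩

/-- Hence a ring homomorphism `S →+* ℤ/pᵏℤ` (reduction modulo `𝔭ᵏ`). [folklore] -/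
theorem nonempty_ringHom_zmod_pow {p : ℕ} (hp : p.Prime) (P : Ideal S) [P.IsPrime]
    [P.LiesOver (span {(p : ℤ)})] (he : ramificationIdx' (span {(p : ℤ)}) P = 1)
    (hf : inertiaDeg' (span {(p : ℤ)}) P = 1) (k : ℕ) :
    Nonempty (S →+* ZMod (p ^ k)) := by
  obtain ⟨e⟩ := nonempty_ringEquiv_zmod_pow hp P he hf k
  exact ⟨e.toRingHom.comp (Ideal.Quotient.mk (P ^ k))⟩

end DegreeOne

/-! ### Totally split primes of a number field -/

section TotallySplit

variable {K : Type*} [Field K] [NumberField K]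

/-- **Totally split primes.** If `p` has `[K : ℚ]` primes of `𝓞 K` above it, then each of them
has `e = f = 1` (fundamental identity `∑ eᵢ fᵢ = [K : ℚ]`, Mathlib
`Ideal.sum_ramification_inertia`; Marcus, *Number Fields*, Ch. 3, Thm. 21). [folklore] -/
theorem ramificationIdx_eq_one_of_ncard_primesOver {p : ℕ} (hp : p.Prime)
    (h : ((span {(p : ℤ)}).primesOver (𝓞 K)).ncard = finrank ℚ K) {P : Ideal (𝓞 K)}
    (hP : P ∈ (span {(p : ℤ)}).primesOver (𝓞 K)) :
    ramificationIdx' (span {(p : ℤ)}) P = 1 ∧ inertiaDeg' (span {(p : ℤ)}) P = 1 := by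
  set q : Ideal ℤ := span {(p : ℤ)} with hq
  have hq0 : q ≠ ⊥ := by simpa [hq] using (Int.natCast_ne_zero.mpr hp.ne_zero)
  haveI : q.IsMaximal := ((span_singleton_prime (Int.natCast_ne_zero.mpr hp.ne_zero)).mpr
      (Nat.prime_iff_prime_int.mp hp)).isMaximal hq0
  have hsum := Ideal.sum_ramification_inertia (R := ℤ) (𝓞 K) ℚ K (p := q) hq0
  have hcard : (IsDedekindDomain.primesOverFinset q (𝓞 K)).card = finrank ℚ K := by
    rw [← h, ← IsDedekindDomain.coe_primesOverFinset hq0 (𝓞 K), Set.ncard_coe_finset]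
  rw [← hcard, Finset.card_eq_sum_ones] at hsum
  have hle : ∀ Q ∈ IsDedekindDomain.primesOverFinset q (𝓞 K),
      1 ≤ ramificationIdx' q Q * inertiaDeg' q Q := fun Q hQ ↦ by
    obtain ⟨hQ1, hQ2⟩ := (IsDedekindDomain.mem_primesOverFinset_iff hq0 (𝓞 K)).mp hQ
    exact Right.one_le_mul
      (Nat.pos_of_ne_zero (IsDedekindDomain.ramificationIdx'_ne_zero_of_liesOver Q hq0))
      (Nat.pos_of_ne_zero (inertiaDeg'_ne_zero q Q))
  have hPf : P ∈ IsDedekindDomain.primesOverFinset q (𝓞 K) :=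
    (IsDedekindDomain.mem_primesOverFinset_iff hq0 (𝓞 K)).mpr hP
  have h1 : ramificationIdx' q P * inertiaDeg' q P = 1 :=
    ((Finset.sum_eq_sum_iff_of_le hle).mp hsum.symm P hPf).symm
  exact ⟨Nat.eq_one_of_mul_eq_one_right h1, Nat.eq_one_of_mul_eq_one_left h1⟩

/-- **A totally split prime gives reductions `𝓞 K → ℤ/pᵏℤ`** for all `k` (Gross 1984, §3;
Gross 1991, §1: "Choose an ideal `𝒩` of `𝒪` with `𝒪/𝒩 ≅ ℤ/Nℤ`", prime-power case). [folklore] -/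
theorem nonempty_ringHom_zmod_pow_of_ncard_primesOver {p : ℕ} (hp : p.Prime)
    (h : ((span {(p : ℤ)}).primesOver (𝓞 K)).ncard = finrank ℚ K) (k : ℕ) :
    Nonempty (𝓞 K →+* ZMod (p ^ k)) := by
  have hne : ((span {(p : ℤ)}).primesOver (𝓞 K)).Nonempty :=
    Set.nonempty_of_ncard_ne_zero (by rw [h]; exact Module.finrank_pos.ne')
  obtain ⟨P, hP⟩ := hne
  haveI : P.IsPrime := hP.1
  haveI : P.LiesOver (span {(p : ℤ)}) := hP.2
  obtain ⟨he, hf⟩ := ramificationIdx_eq_one_of_ncard_primesOver hp h hP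
  exact Literature.NumberTheory.QuadraticFields.SplitPrime.nonempty_ringHom_zmod_pow hp P he hf k

/-! ### The ideal `𝔫` with `𝓞 K ⧸ 𝔫 ≅ ℤ/Nℤ` -/

omit [NumberField K] in
/-- Primes of `𝓞 K` above distinct rational primes are distinct. [folklore] -/
theorem ne_of_liesOver_of_ne {p q : ℕ} (hp : p.Prime) (hq : q.Prime) (hpq : p ≠ q)
    (P Q : Ideal (𝓞 K)) [P.IsPrime] [P.LiesOver (span {(p : ℤ)})] [Q.LiesOver (span {(q : ℤ)})] :
    P ≠ Q := by
  intro hPQ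
  have hpP : ((p : ℤ) : 𝓞 K) ∈ P := by
    have h : (p : ℤ) ∈ P.under ℤ := by
      rw [← P.over_def (span {(p : ℤ)})]; exact Ideal.mem_span_singleton_self _
    simpa [Ideal.under_def] using h
  have hqP : ((q : ℤ) : 𝓞 K) ∈ P := by
    have h : (q : ℤ) ∈ Q.under ℤ := by
      rw [← Q.over_def (span {(q : ℤ)})]; exact Ideal.mem_span_singleton_self _
    rw [← hPQ] at h
    simpa [Ideal.under_def] using h
  obtain ⟨u, v, huv⟩ : IsCoprime (p : ℤ) (q : ℤ) :=
    Nat.isCoprime_iff_coprime.mpr ((Nat.coprime_primes hp hq).mpr hpq)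
  have h1 : (1 : 𝓞 K) ∈ P := by
    have := P.add_mem (P.mul_mem_left (u : 𝓞 K) hpP) (P.mul_mem_left (v : 𝓞 K) hqP)
    rwa [← Int.cast_mul, ← Int.cast_mul, ← Int.cast_add, huv, Int.cast_one] at this
  exact Ideal.IsPrime.ne_top ‹_› ((Ideal.eq_top_iff_one P).mpr h1)

/-- **The ideal `𝔫` with `𝓞_K/𝔫 ≅ ℤ/Nℤ`.** If every prime `p ∣ N` (`N ≥ 1`) is totally split in the
number field `K`, then choosing one prime `𝔭_p` above each `p ∣ N` and setting
`𝔫 = ∏ 𝔭_p^{v_p(N)}` gives `𝓞 K ⧸ 𝔫 ≅ ℤ/Nℤ` (Chinese remainder theorem and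
`𝓞 K ⧸ 𝔭_pᵏ ≅ ℤ/pᵏ`). This is the standing choice "Choose an ideal `𝒩` of `𝒪` with
`𝒪/𝒩 ≅ ℤ/Nℤ`" of Gross 1991, §1 (p. 235) under the Heegner hypothesis "all prime factors of `N`
are split"; Gross 1984, §3; Darmon 2004, Prop. 3.8. [cite: Gross1991, §1] -/
theorem exists_ideal_quotient_ringEquiv_zmod {N : ℕ} (hN : N ≠ 0)
    (hH : ∀ p : ℕ, p.Prime → p ∣ N →
      ((span {(p : ℤ)}).primesOver (𝓞 K)).ncard = finrank ℚ K) :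
    ∃ 𝔫 : Ideal (𝓞 K), Nonempty (𝓞 K ⧸ 𝔫 ≃+* ZMod N) := by
  have hpr : ∀ p : N.primeFactors, (p : ℕ).Prime := fun p ↦ Nat.prime_of_mem_primeFactors p.2
  have hdv : ∀ p : N.primeFactors, (p : ℕ) ∣ N := fun p ↦ Nat.dvd_of_mem_primeFactors p.2
  have hne : ∀ p : N.primeFactors, ((span {((p : ℕ) : ℤ)}).primesOver (𝓞 K)).Nonempty :=
    fun p ↦ Set.nonempty_of_ncard_ne_zero
      (by rw [hH p (hpr p) (hdv p)]; exact Module.finrank_pos.ne')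
  choose 𝔭 h𝔭 using hne
  set k : N.primeFactors → ℕ := fun p ↦ N.factorization p with hk
  haveI hP : ∀ p : N.primeFactors, (𝔭 p).IsPrime := fun p ↦ (h𝔭 p).1
  haveI hL : ∀ p : N.primeFactors, (𝔭 p).LiesOver (span {((p : ℕ) : ℤ)}) := fun p ↦ (h𝔭 p).2
  have hef : ∀ p : N.primeFactors, ramificationIdx' (span {((p : ℕ) : ℤ)}) (𝔭 p) = 1 ∧
      inertiaDeg' (span {((p : ℕ) : ℤ)}) (𝔭 p) = 1 :=
    fun p ↦ ramificationIdx_eq_one_of_ncard_primesOver (hpr p) (hH p (hpr p) (hdv p)) (h𝔭 p)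
  have e : ∀ p : N.primeFactors, 𝓞 K ⧸ 𝔭 p ^ k p ≃+* ZMod ((p : ℕ) ^ k p) := fun p ↦
    (Literature.NumberTheory.QuadraticFields.SplitPrime.nonempty_ringEquiv_zmod_pow (hpr p) (𝔭 p) (hef p).1 (hef p).2 (k p)).some
  have hcop : Pairwise (Function.onFun IsCoprime fun p : N.primeFactors ↦ 𝔭 p ^ k p) := by
    intro p q hpq
    have hp0 : ∀ r : N.primeFactors, (span {((r : ℕ) : ℤ)} : Ideal ℤ) ≠ ⊥ := fun r ↦ by
      simpa using (Int.natCast_ne_zero.mpr (hpr r).ne_zero)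
    have hmax : ∀ r : N.primeFactors, (𝔭 r).IsMaximal := fun r ↦
      (hP r).isMaximal (ne_bot_of_liesOver_of_ne_bot (hp0 r) (𝔭 r))
    have hne : 𝔭 p ≠ 𝔭 q := ne_of_liesOver_of_ne (hpr p) (hpr q)
      (fun h ↦ hpq (Subtype.ext h)) (𝔭 p) (𝔭 q)
    haveI := hmax p
    haveI := hmax q
    exact (Ideal.isCoprime_of_isMaximal hne).pow
  refine ⟨⨅ p, 𝔭 p ^ k p, ⟨(Ideal.quotientInfRingEquivPiQuotient _ hcop).trans
    ((RingEquiv.piCongrRight e).trans (ZMod.equivPi N hN).symm)⟩⟩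

end TotallySplit

end Literature.NumberTheory.QuadraticFields.SplitPrime

/-! ### Square roots of `d_K` modulo `4N` (the Heegner condition) -/

namespace Literature.NumberTheory.QuadraticFields.Quadratic

open Ideal

variable {K : Type*} [Field K] [NumberField K]

/-- If `a ∣ β − x` and `a ∣ x² − D` then `a ∣ β² − D`. [folklore] -/
theorem _root_.Int.dvd_sq_sub_of_dvd_sub {a x β D : ℤ} (h1 : a ∣ β - x) (h2 : a ∣ x ^ 2 - D) :
    a ∣ β ^ 2 - D := by
  rw [show β ^ 2 - D = (β - x) * (β + x) + (x ^ 2 - D) by ring]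
  exact (h1.mul_right _).add h2

/-- **Chinese remainder theorem for square roots**: an integer `D` that is a square modulo every
prime power dividing `M ≠ 0` is a square modulo `M`. [folklore] -/
theorem _root_.Int.exists_dvd_sq_sub_of_forall_prime_pow {D : ℤ} {M : ℕ} (hM : M ≠ 0)
    (h : ∀ p k : ℕ, p.Prime → p ^ k ∣ M → ∃ β : ℤ, (p : ℤ) ^ k ∣ β ^ 2 - D) :
    ∃ β : ℤ, (M : ℤ) ∣ β ^ 2 - D := by
  induction M using Nat.recOnPosPrimePosCoprime with
  | prime_pow p n hpp hn =>
    obtain ⟨β, hβ⟩ := h p n hpp dvd_rfl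
    exact ⟨β, by exact_mod_cast hβ⟩
  | zero => exact absurd rfl hM
  | one => exact ⟨0, by simp⟩
  | coprime a b ha hb hab iha ihb =>
    obtain ⟨x, hx⟩ := iha (by omega) fun p k hp hk ↦ h p k hp (hk.mul_right b)
    obtain ⟨y, hy⟩ := ihb (by omega) fun p k hp hk ↦ h p k hp (hk.mul_left a)
    have hcop : IsCoprime (a : ℤ) (b : ℤ) := Nat.isCoprime_iff_coprime.mpr hab
    obtain ⟨u, v, huv⟩ := hcop
    refine ⟨y * u * a + x * v * b, ?_⟩
    push_cast
    refine IsCoprime.mul_dvd (Nat.isCoprime_iff_coprime.mpr hab) ?_ ?_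
    · refine Int.dvd_sq_sub_of_dvd_sub ⟨y * u - x * u, ?_⟩ hx
      linear_combination x * huv
    · refine Int.dvd_sq_sub_of_dvd_sub ⟨x * v - y * v, ?_⟩ hy
      linear_combination y * huv

/-- **The Heegner condition.** If `[K : ℚ] = 2` and every prime `p ∣ N` (`N ≥ 1`) splits in `K`
(two primes of `𝓞 K` above `p`), then `d_K` is a square modulo `4N`: `d_K ≡ β² (mod 4N)` for some
`β ∈ ℤ`. For `p ∣ N` reduce `δ = √d_K ∈ 𝓞 K` modulo `𝔭ᵏ`, `𝓞 K/𝔭ᵏ ≅ ℤ/pᵏ`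
(`nonempty_ringHom_zmod_pow_of_ncard_primesOver`); at `2 ∤ N` use `d_K ≡ t² (mod 4)`; glue by
the Chinese remainder theorem. This is the form in which the Heegner hypothesis enters the
construction of Heegner points: Gross 1984, §3 and Gross–Zagier 1986, I.§3 (`D ≡ β² (mod 4N)`,
the ideal `𝔫 = (N, (β + √D)/2)` with `𝓞/𝔫 ≅ ℤ/Nℤ`); Gross 1991, §1 ("where all prime factors of
`N` are split … Choose an ideal `𝒩` of `𝒪` with `𝒪/𝒩 ≅ ℤ/Nℤ`"); Darmon 2004, Prop. 3.8.
[cite: Gross1984, §3] -/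
theorem exists_dvd_sq_sub_discr_of_ncard_primesOver (h2 : finrank ℚ K = 2) {N : ℕ} (hN : N ≠ 0)
    (hH : ∀ p : ℕ, p.Prime → p ∣ N → ((span {(p : ℤ)}).primesOver (𝓞 K)).ncard = 2) :
    ∃ β : ℤ, (4 * N : ℤ) ∣ β ^ 2 - NumberField.discr K := by
  obtain ⟨t, m, δ, hD, hδ⟩ := exists_sq_eq_discr h2
  suffices h : ∃ β : ℤ, ((4 * N : ℕ) : ℤ) ∣ β ^ 2 - NumberField.discr K by
    simpa only [Nat.cast_mul, Nat.cast_ofNat] using h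
  refine Int.exists_dvd_sq_sub_of_forall_prime_pow (by positivity) fun p k hp hpk ↦ ?_
  by_cases hpN : p ∣ N
  · obtain ⟨f⟩ := Literature.NumberTheory.QuadraticFields.SplitPrime.nonempty_ringHom_zmod_pow_of_ncard_primesOver hp
      ((hH p hp hpN).trans h2.symm) k
    obtain ⟨β, hβ⟩ := ZMod.intCast_surjective (f δ)
    haveI : NeZero (p ^ k) := ⟨pow_ne_zero _ hp.ne_zero⟩
    refine ⟨β, ?_⟩
    have h0 : ((β ^ 2 - NumberField.discr K : ℤ) : ZMod (p ^ k)) = 0 := by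
      push_cast
      rw [hβ, ← map_pow, hδ, map_intCast, sub_self]
    exact_mod_cast (ZMod.intCast_zmod_eq_zero_iff_dvd _ _).mp h0
  · have h4 : p ^ k ∣ 4 :=
      (Nat.Coprime.pow_left k ((Nat.Prime.coprime_iff_not_dvd hp).mpr hpN)).dvd_of_dvd_mul_right hpk
    refine ⟨t, ?_⟩
    rw [hD, show t ^ 2 - (t ^ 2 + 4 * m) = 4 * (-m) by ring]
    exact (show (p : ℤ) ^ k ∣ 4 by exact_mod_cast h4).mul_right _

/-- **Heegner hypothesis ⇒ `𝓞_K/𝔫 ≅ ℤ/Nℤ`, quadratic case**: if `[K : ℚ] = 2` and every prime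
`p ∣ N` has two primes of `𝓞 K` above it, there is an ideal `𝔫` of `𝓞 K` with `𝓞 K ⧸ 𝔫 ≅ ℤ/Nℤ`
(Gross 1991, §1, p. 235; Gross 1984, §3; Darmon 2004, Prop. 3.8). [cite: Gross1991, §1] -/
theorem exists_ideal_quotient_ringEquiv_zmod_of_ncard_eq_two (h2 : finrank ℚ K = 2) {N : ℕ}
    (hN : N ≠ 0) (hH : ∀ p : ℕ, p.Prime → p ∣ N → ((span {(p : ℤ)}).primesOver (𝓞 K)).ncard = 2) :
    ∃ 𝔫 : Ideal (𝓞 K), Nonempty (𝓞 K ⧸ 𝔫 ≃+* ZMod N) :=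
  Literature.NumberTheory.QuadraticFields.SplitPrime.exists_ideal_quotient_ringEquiv_zmod hN fun p hp hpN ↦ (hH p hp hpN).trans h2.symm

end Literature.NumberTheory.QuadraticFields.Quadratic
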